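/-
Copyright (c) 2026. All rights reserved.
Released under Apache 2.0 license as described in the file LICENSE.
-/
import Mathlib.Analysis.SpecialFunctions.Exponential
import Mathlib.Analysis.SpecialFunctions.ExpDeriv
import Literature.NumberTheory.Automorphic.ArchimedeanSecondKindChart
import Literature.Analysis.OperatorTheory.NormContinuousGroup
import HarnessLib

/-!
# Continuous characters of a linear real group are smooth

Topic `NumberTheory/Automorphic` (continuation of `ArchimedeanSecondKindChart`). Let `H` be a linear real
group (`RealMatrixGroup A N`) with full Lie algebra `𝔤` (hypothesis `hreg` of `ArchimedeanCalculusRegular`)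
and let `χ : H →* ℂ` be a multiplicative character which is continuous along the one-parameter subgroups
`s ↦ exp (s Xᵢ)` of a basis `X₀, …, X_{d-1}` of `𝔤` (for instance: `χ` continuous). Then

* `exists_apply_expMem_smul_eq_cexp` — each `s ↦ χ (exp (s Xᵢ))` is an exponential `e^{s aᵢ}`
  (von Neumann 1929 / Engel–Nagel 2000, Ch. I Thm. 3.7, the case `A = ℂ` of the tree's
  `NormContinuousGroup.exists_eq_exp_smul_of_continuous`);
* `apply_skProd_eq_cexp` — along the second-kind coordinate map `Ψ (t) = ∏ exp (tᵢ Xᵢ)`,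
  `χ (Ψ t) = e^{∑ tᵢ aᵢ}`;
* `contDiffAt_character` — **main theorem**: for every `c : B → H` from a real normed space which is `C^∞` at
  `x₀` as a matrix-valued map, `x ↦ χ (c x)` is `C^∞` at `x₀` (canonical coordinates of the second kind,
  `RealMatrixGroup.exists_secondKindCoords`, Varadarajan 1984 Thm. 2.10.1: near `x₀`,
  `χ (c x) = χ (Ψ (τ (c x · g₀⁻¹))) · χ (g₀) = e^{∑ τᵢ(…) aᵢ} χ (g₀)` with `τ` smooth at `1`);
* `exists_character_differential` — hence a continuous character has a DIFFERENTIAL: a real-linear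
  `δ : 𝔤 → ℂ` with `χ (exp X) = e^{δ (X)}` for all `X ∈ 𝔤` (the hypothesis `hc` of
  `ArchimedeanCharacterTwist.isArchSmooth_mulChar_of_exp`, discharged for every continuous character);
* `contDiffAt_smul_of_forall` — multiplication by a smooth scalar `f` preserves the weak smoothness
  `x ↦ T (v x)` of a vector-valued map tested against all continuous real-linear `T`
  (`T (f • v) = (Re f) T v + (Im f) T (I • v)`).

This is É. Cartan's theorem «a continuous homomorphism of Lie groups is real-analytic» in the special case of
characters, proved here with the elementary tools already in the tree; it is the regularity input that lets a
datum twisted by a continuous character (`Weil1964.charTwist`, two archimedean Weil data over the same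
symplectic action differ by such a character: `IsArchWeilDatum.exists_continuous_character`) inherit every
differentiability statement of the untwisted one. Everything here is kernel-proved; there are no records and no
named facts.

## References

* V. S. Varadarajan, *Lie Groups, Lie Algebras, and Their Representations*, Springer GTM 102 (1984),
  Thm. 2.10.1, (2.10.19) (p. 89) and Thm. 2.11.2, p. 138 («π is analytic iff π ∘ α is continuous for every
  one-parameter α; in particular a continuous homomorphism is analytic», proof via the basis letters
  `ηᵢ (t) = π (exp tXᵢ)` — the shape of `contDiffAt_character`). [Varadarajan1984]
* K.-J. Engel, R. Nagel, *One-Parameter Semigroups for Linear Evolution Equations*, Springer GTM 194 (2000),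
  Ch. I Thm. 3.7. [EngelNagel2000]
-/

-- Mathlib idiom (Mathlib/Algebra/Lie/OfAssociative.lean); needed to mention Lie subalgebras of matrix algebras
attribute [local instance 100] LieRing.ofAssociativeRing

noncomputable section

open scoped MatrixGroups Matrix Topology ContDiff
open Filter

namespace Literature.NumberTheory.Automorphic

/-! ## 1. Continuous one-parameter characters are exponentials -/

/-- **A continuous one-parameter character of `ℝ` is an exponential**: `φ` continuous, `φ 0 = 1`,
`φ (s + t) = φ s φ t` ⇒ `φ t = e^{t a}` for one `a ∈ ℂ` (the Banach algebra `ℂ` case of the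
Engel–Nagel theorem `exists_eq_exp_smul_of_continuous`). [cite: EngelNagel2000, Ch. I Thm 3.7] -/
theorem exists_eq_cexp_of_continuous {φ : ℝ → ℂ} (hφ : Continuous φ) (h0 : φ 0 = 1)
    (hmul : ∀ s t, φ (s + t) = φ s * φ t) : ∃ a : ℂ, ∀ t : ℝ, φ t = Complex.exp (t * a) := by
  letI : NormedAlgebra ℚ ℂ := NormedAlgebra.restrictScalars ℚ ℝ ℂ
  obtain ⟨a, ha⟩ := Literature.Analysis.OperatorTheory.exists_eq_exp_smul_of_continuous hφ h0 hmul
  refine ⟨a, fun t => ?_⟩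
  rw [ha t, Complex.exp_eq_exp_ℂ, Complex.real_smul]

/-- … and is therefore `C^∞`. [cite: EngelNagel2000, Ch. I Thm 3.7] -/
theorem contDiff_of_continuous_character {φ : ℝ → ℂ} (hφ : Continuous φ) (h0 : φ 0 = 1)
    (hmul : ∀ s t, φ (s + t) = φ s * φ t) : ContDiff ℝ ∞ φ := by
  obtain ⟨a, ha⟩ := exists_eq_cexp_of_continuous hφ h0 hmul
  have h : φ = fun t : ℝ => Complex.exp ((t : ℂ) * a) := funext ha
  rw [h]
  exact (Complex.contDiff_exp (𝕜 := ℝ)).comp ((Complex.ofRealCLM.contDiff).mul contDiff_const)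

/-! ## 2. Characters of a linear real group -/

variable {A : Type*} [NormedCommRing A] [NormedAlgebra ℝ A] [NormedAlgebra ℚ A] [CompleteSpace A]
  [StarRing A] {N : Type*} [Fintype N] [DecidableEq N] (H : RealMatrixGroup A N)

namespace RealMatrixGroup

/-- `exp ((s + t) X) = exp (s X) exp (t X)` in `H` (private copy of `RealMatrixGroup.expMem_add_smul` of
`AutomorphicFormsL2Derivative`, not imported here). Knapp, 0.§2, Prop. 0.11 (c). [folklore] -/
private theorem expMem_add_smul' (s t : ℝ) (X : H.lie) :
    H.expMem ((s + t) • X) = H.expMem (s • X) * H.expMem (t • X) := by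
  refine Subtype.ext ?_
  change expGL (((s + t) • X : H.lie) : Matrix N N A) =
    expGL ((s • X : H.lie) : Matrix N N A) * expGL ((t • X : H.lie) : Matrix N N A)
  exact expGL_add_smul s t (X : Matrix N N A)

/-- `exp (0 · X) = 1` in `H` (private copy of `RealMatrixGroup.expMem_zero_smul`). [folklore] -/
private theorem expMem_zero_smul' (X : H.lie) : H.expMem ((0 : ℝ) • X) = 1 := by
  refine Subtype.ext (Units.ext ?_)
  change NormedSpace.exp ((((0 : ℝ) • X : H.lie)) : Matrix N N A) = 1
  rw [show ((((0 : ℝ) • X : H.lie)) : Matrix N N A) = (0 : ℝ) • (X : Matrix N N A) from rfl,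
    zero_smul, NormedSpace.exp_zero]

set_option backward.isDefEq.respectTransparency false in
open scoped Matrix.Norms.Operator in
/-- `t ↦ exp (t X) ∈ H` is continuous (private copy of `RealMatrixGroup.continuous_expMem_smul` of
`ArchFlowParametricIntegral`, not imported here). [folklore] -/
private theorem continuous_expMem_smul' (X : H.lie) : Continuous fun t : ℝ => H.expMem (t • X) := by
  refine Continuous.subtype_mk ?_ _
  change Continuous fun t : ℝ => expGL (((t • X : H.lie) : Matrix N N A))
  have h : ∀ t : ℝ, (((t • X : H.lie) : Matrix N N A)) = t • (X : Matrix N N A) := fun t => rfl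
  simp only [h]
  refine Units.continuous_iff.2 ⟨?_, ?_⟩
  · change Continuous fun t : ℝ => ((expGL (t • (X : Matrix N N A)) : GL N A) : Matrix N N A)
    simp only [coe_expGL]
    exact NormedSpace.exp_continuous.comp (continuous_id.smul continuous_const)
  · have h' : ∀ t : ℝ, (((expGL (t • (X : Matrix N N A)))⁻¹ : GL N A) : Matrix N N A) =
        NormedSpace.exp ((-t) • (X : Matrix N N A)) := fun t => by
      rw [← expGL_neg, coe_expGL, neg_smul]
    change Continuous fun t : ℝ => (((expGL (t • (X : Matrix N N A)))⁻¹ : GL N A) : Matrix N N A)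
    simp only [h']
    exact NormedSpace.exp_continuous.comp (continuous_neg.smul continuous_const)

/-- A character continuous on `H` is continuous along every one-parameter subgroup. [folklore] -/
theorem continuous_character_expMem_smul {χ : H.carrier →* ℂ} (hχ : Continuous χ) (X : H.lie) :
    Continuous fun s : ℝ => χ (H.expMem (s • X)) :=
  hχ.comp (H.continuous_expMem_smul' X)

/-- **The letters of a character**: along a one-parameter subgroup a character of `H`, continuous there,
is `χ (exp (s X)) = e^{s a}` for one `a ∈ ℂ`. [cite: EngelNagel2000, Ch. I Thm 3.7] -/
theorem exists_apply_expMem_smul_eq_cexp (χ : H.carrier →* ℂ) (X : H.lie)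
    (hχ : Continuous fun s : ℝ => χ (H.expMem (s • X))) :
    ∃ a : ℂ, ∀ s : ℝ, χ (H.expMem (s • X)) = Complex.exp (s * a) :=
  exists_eq_cexp_of_continuous hχ (by rw [expMem_zero_smul', map_one])
    (fun s t => by rw [expMem_add_smul', map_mul])

/-- **A character along `Ψ_X`**: if `χ (exp (s Xᵢ)) = e^{s aᵢ}` for all `i`, `s`, then
`χ (Ψ_X (t)) = e^{∑ᵢ tᵢ aᵢ}`. [folklore] -/
theorem apply_skProd_eq_cexp (χ : H.carrier →* ℂ) :
    ∀ (d : ℕ) (X : Fin d → H.lie) (a : Fin d → ℂ)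
      (_ : ∀ (i : Fin d) (s : ℝ), χ (H.expMem (s • X i)) = Complex.exp (s * a i)) (t : Fin d → ℝ),
      χ (H.skProd d X t) = Complex.exp (∑ i, (t i : ℂ) * a i)
  | 0, X, a, _, t => by
    rw [skProd_zero_left, map_one, Finset.univ_eq_empty, Finset.sum_empty, Complex.exp_zero]
  | d + 1, X, a, h, t => by
    rw [skProd_succ, map_mul, h 0 (t 0),
      apply_skProd_eq_cexp χ d (Fin.tail X) (Fin.tail a) (fun i => h i.succ) (Fin.tail t), ← Complex.exp_add,
      Fin.sum_univ_succ]
    rfl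

/-- `t ↦ e^{∑ tᵢ aᵢ}` is `C^∞` on `ℝ^d`. [folklore] -/
theorem contDiff_cexp_sum {d : ℕ} (a : Fin d → ℂ) :
    ContDiff ℝ ∞ fun t : Fin d → ℝ => Complex.exp (∑ i, (t i : ℂ) * a i) := by
  refine (Complex.contDiff_exp (𝕜 := ℝ)).comp ?_
  refine ContDiff.sum fun i _ => ?_
  exact (Complex.ofRealCLM.contDiff.comp (contDiff_apply ℝ ℝ i)).mul contDiff_const

set_option backward.isDefEq.respectTransparency false in
open scoped Matrix.Norms.Operator in
/-- **Continuous characters of a linear real group are smooth.** Let `H` have full Lie algebra `𝔤` over a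
finite-dimensional coefficient algebra, let `X₀, …, X_{d-1} ∈ 𝔤` have the matrices of an `ℝ`-basis `b` of
`𝔤`, and let `χ : H →* ℂ` be continuous along each `s ↦ exp (s Xᵢ)`. Then for every `c : B → H` which is
`C^∞` at `x₀` as a matrix-valued map, `x ↦ χ (c x)` is `C^∞` at `x₀`.
[cite: Varadarajan1984, Thm. 2.10.1 and (2.10.19), p. 89] -/
theorem contDiffAt_character [FiniteDimensional ℝ A]
    (hreg : ∀ X : Matrix N N A, (∀ t : ℝ, expGL (t • X) ∈ H.carrier) → X ∈ H.lie)
    {d : ℕ} (X : Fin d → H.lie) (b : Module.Basis (Fin d) ℝ H.lie.toSubmodule)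
    (hXb : ∀ i, (X i : Matrix N N A) = (b i : Matrix N N A))
    (χ : H.carrier →* ℂ) (hχ : ∀ i, Continuous fun s : ℝ => χ (H.expMem (s • X i)))
    {B : Type*} [NormedAddCommGroup B] [NormedSpace ℝ B] {c : B → H.carrier} {x₀ : B}
    (hc : ContDiffAt ℝ ∞ (fun x => ((c x : GL N A) : Matrix N N A)) x₀) :
    ContDiffAt ℝ ∞ (fun x => χ (c x)) x₀ := by
  choose a ha using fun i => H.exists_apply_expMem_smul_eq_cexp χ (X i) (hχ i)
  obtain ⟨τ, hτ, -, hchart⟩ := H.exists_secondKindCoords hreg b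
  have hXeq : (fun i => (⟨(b i : Matrix N N A), (b i).2⟩ : H.lie)) = X :=
    funext fun i => Subtype.ext (hXb i).symm
  rw [hXeq] at hchart
  -- the recentred curve `u x = c x · g₀⁻¹`, `g₀ = c x₀`
  set g₀ : H.carrier := c x₀ with hg₀_def
  have hcoe : (fun x => (((c x * g₀⁻¹ : H.carrier) : GL N A) : Matrix N N A)) =
      fun x => ((c x : GL N A) : Matrix N N A) * (((g₀⁻¹ : H.carrier) : GL N A) : Matrix N N A) := by
    funext x
    rw [Subgroup.coe_mul, Units.val_mul]
  have hu : ContDiffAt ℝ ∞ (fun x => (((c x * g₀⁻¹ : H.carrier) : GL N A) : Matrix N N A)) x₀ := by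
    rw [hcoe]
    exact hc.mul contDiffAt_const
  have hut : Tendsto (fun x => (c x * g₀⁻¹ : H.carrier)) (𝓝 x₀) (𝓝 1) := by
    have h := (H.continuousAt_of_coe hu.continuousAt).tendsto
    rwa [hg₀_def, mul_inv_cancel] at h
  -- near `x₀`: `Ψ_X (τ (u x)) = u x`, hence `χ (c x) = e^{∑ τᵢ aᵢ} · χ g₀`
  have hEq : (fun x => χ (c x)) =ᶠ[𝓝 x₀]
      fun x => Complex.exp (∑ i, ((τ (((c x * g₀⁻¹ : H.carrier) : GL N A) : Matrix N N A) i : ℝ) : ℂ) * a i)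
        * χ g₀ := by
    filter_upwards [hut.eventually hchart] with x hx
    rw [← H.apply_skProd_eq_cexp χ d X a ha, hx, ← map_mul, inv_mul_cancel_right]
  refine ContDiffAt.congr_of_eventuallyEq ?_ hEq
  have hτ' : ContDiffAt ℝ ∞ τ (((c x₀ * g₀⁻¹ : H.carrier) : GL N A) : Matrix N N A) := by
    rw [hg₀_def, mul_inv_cancel, show (((1 : H.carrier) : GL N A) : Matrix N N A) = 1 from rfl]
    exact hτ
  exact ((contDiff_cexp_sum a).contDiffAt.comp x₀ (hτ'.comp x₀ hu)).mul contDiffAt_const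

set_option backward.isDefEq.respectTransparency false in
open scoped Matrix.Norms.Operator in
/-- **… in particular for a character continuous on `H`.** [cite: Varadarajan1984, Thm. 2.11.2, p. 138] -/
theorem contDiffAt_character_of_continuous [FiniteDimensional ℝ A]
    (hreg : ∀ X : Matrix N N A, (∀ t : ℝ, expGL (t • X) ∈ H.carrier) → X ∈ H.lie)
    {d : ℕ} (X : Fin d → H.lie) (b : Module.Basis (Fin d) ℝ H.lie.toSubmodule)
    (hXb : ∀ i, (X i : Matrix N N A) = (b i : Matrix N N A))
    {χ : H.carrier →* ℂ} (hχ : Continuous χ)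
    {B : Type*} [NormedAddCommGroup B] [NormedSpace ℝ B] {c : B → H.carrier} {x₀ : B}
    (hc : ContDiffAt ℝ ∞ (fun x => ((c x : GL N A) : Matrix N N A)) x₀) :
    ContDiffAt ℝ ∞ (fun x => χ (c x)) x₀ :=
  H.contDiffAt_character hreg X b hXb χ (fun i => H.continuous_character_expMem_smul hχ (X i)) hc

set_option backward.isDefEq.respectTransparency false in
open scoped Matrix.Norms.Operator in
/-- `Y ↦ exp Y : 𝔤 → H` is `C^∞` as a matrix-valued map on the normed space `𝔤`. [folklore] -/
theorem contDiffAt_coe_expMem_mk (Y₀ : H.lie.toSubmodule) :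
    ContDiffAt ℝ ∞ (fun Y : H.lie.toSubmodule =>
      (((H.expMem ⟨(Y : Matrix N N A), Y.2⟩ : H.carrier) : GL N A) : Matrix N N A)) Y₀ := by
  have hfun : (fun Y : H.lie.toSubmodule =>
      (((H.expMem ⟨(Y : Matrix N N A), Y.2⟩ : H.carrier) : GL N A) : Matrix N N A)) =
      fun Y => NormedSpace.exp ((H.lie.toSubmodule.subtypeL : H.lie.toSubmodule →L[ℝ] Matrix N N A) Y) := rfl
  rw [hfun]
  exact (NormedSpace.exp_analytic (𝕂 := ℝ) ((H.lie.toSubmodule.subtypeL : _ →L[ℝ] Matrix N N A) Y₀)).contDiffAt.comp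
    Y₀ (ContinuousLinearMap.contDiff _).contDiffAt

set_option backward.isDefEq.respectTransparency false in
open scoped Matrix.Norms.Operator in
/-- **Continuous characters have a differential.** For `H` with full Lie algebra over a finite-dimensional
coefficient algebra and a continuous character `χ : H →* ℂ` there is a real-linear `δ : 𝔤 → ℂ` with
`χ (exp X) = e^{δ (X)}` for ALL `X ∈ 𝔤` (`δ` = the derivative at `0` of the smooth map `X ↦ χ (exp X)`; along each ray
`t ↦ χ (exp tX) = e^{t a_X}` and `a_X = δ X` by uniqueness of derivatives). This is the hypothesis `hc` of
`ArchimedeanCharacterTwist.isArchSmooth_mulChar_of_exp`, discharged for every continuous character.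
[cite: Varadarajan1984, Thm. 2.11.2, p. 138] -/
theorem exists_character_differential [FiniteDimensional ℝ A]
    (hreg : ∀ X : Matrix N N A, (∀ t : ℝ, expGL (t • X) ∈ H.carrier) → X ∈ H.lie)
    {d : ℕ} (b : Module.Basis (Fin d) ℝ H.lie.toSubmodule) {χ : H.carrier →* ℂ} (hχ : Continuous χ) :
    ∃ δ : H.lie →ₗ[ℝ] ℂ, ∀ X : H.lie, χ (H.expMem X) = Complex.exp (δ X) := by
  -- `F Y = χ (exp Y)` on the normed space `𝔤`, smooth everywhere
  set F : H.lie.toSubmodule → ℂ := fun Y => χ (H.expMem ⟨(Y : Matrix N N A), Y.2⟩) with hF_def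
  have hFs : ∀ Y₀ : H.lie.toSubmodule, ContDiffAt ℝ ∞ F Y₀ := fun Y₀ =>
    H.contDiffAt_character_of_continuous hreg (fun i => ⟨(b i : Matrix N N A), (b i).2⟩) b (fun _ => rfl) hχ
      (H.contDiffAt_coe_expMem_mk Y₀)
  -- its derivative at `0`
  set δL : H.lie.toSubmodule →L[ℝ] ℂ := fderiv ℝ F 0 with hδL_def
  have hF0 : HasFDerivAt F δL 0 := ((hFs 0).differentiableAt (by simp)).hasFDerivAt
  refine ⟨{ toFun := fun X => δL ⟨(X : Matrix N N A), X.2⟩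
            map_add' := fun X X' => by rw [← map_add]; rfl
            map_smul' := fun r X => by rw [RingHom.id_apply, ← map_smul]; rfl }, fun X => ?_⟩
  set Y : H.lie.toSubmodule := ⟨(X : Matrix N N A), X.2⟩ with hY_def
  change χ (H.expMem X) = Complex.exp (δL Y)
  -- along the ray: `F (t • Y) = χ (exp (t X)) = e^{t a}`
  obtain ⟨a, ha⟩ := H.exists_apply_expMem_smul_eq_cexp χ X (H.continuous_character_expMem_smul hχ X)
  have hray : ∀ t : ℝ, F (t • Y) = χ (H.expMem (t • X)) := fun t => rfl
  have hfun : (fun t : ℝ => F (t • Y)) = fun t : ℝ => Complex.exp ((t : ℂ) * a) :=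
    funext fun t => (hray t).trans (ha t)
  -- two derivatives at `t = 0`: `δL Y` (chain rule) and `a`
  have h1 : HasDerivAt (fun t : ℝ => F (t • Y)) (δL Y) 0 := by
    have hs : HasDerivAt (fun t : ℝ => t • Y) Y 0 := by
      simpa using (hasDerivAt_id (0 : ℝ)).smul_const Y
    have hF0' : HasFDerivAt F δL ((0 : ℝ) • Y) := by rwa [zero_smul]
    exact hF0'.comp_hasDerivAt 0 hs
  have h2 : HasDerivAt (fun t : ℝ => F (t • Y)) a 0 := by
    rw [hfun]
    have h := ((Complex.ofRealCLM.hasDerivAt (x := (0 : ℝ))).mul_const a).cexp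
    simpa using h
  have hδa : δL Y = a := h1.unique h2
  -- at `t = 1`
  have h3 : χ (H.expMem X) = F ((1 : ℝ) • Y) := by rw [one_smul]
  rw [h3, hray 1, ha 1, hδa, Complex.ofReal_one, one_mul]

end RealMatrixGroup

/-! ## 3. Twisting a weakly smooth vector-valued map by a smooth scalar -/

section Smul

variable {B : Type*} [NormedAddCommGroup B] [NormedSpace ℝ B]
  {E : Type*} [AddCommGroup E] [Module ℂ E] [TopologicalSpace E] [ContinuousConstSMul ℂ E]
  {V : Type*} [NormedAddCommGroup V] [NormedSpace ℝ V]

omit [TopologicalSpace E] [ContinuousConstSMul ℂ E] in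
/-- `T (z • v) = (Re z) • T v + (Im z) • T (I • v)` for a real-linear `T` on a complex space. [folklore] -/
theorem map_complex_smul_eq (T : E →ₗ[ℝ] V) (z : ℂ) (v : E) :
    T (z • v) = z.re • T v + z.im • T (Complex.I • v) := by
  conv_lhs => rw [← Complex.re_add_im z]
  rw [add_smul, mul_smul, Complex.coe_smul, Complex.coe_smul, map_add, T.map_smul, T.map_smul]

/-- **Weak smoothness is stable under a smooth scalar twist.** If `x ↦ f x ∈ ℂ` is `C^n` at `x₀` and
`x ↦ T (v x)` is `C^n` at `x₀` for EVERY continuous real-linear `T : E → V`, then so is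
`x ↦ T (f x • v x)` for every such `T`. [folklore] -/
theorem contDiffAt_smul_of_forall {n : WithTop ℕ∞} {f : B → ℂ} {v : B → E} {x₀ : B}
    (hf : ContDiffAt ℝ n f x₀) (hv : ∀ T : E →L[ℝ] V, ContDiffAt ℝ n (fun x => T (v x)) x₀)
    (T : E →L[ℝ] V) : ContDiffAt ℝ n (fun x => T (f x • v x)) x₀ := by
  -- the real-linear continuous map `w ↦ I • w`
  let J : E →L[ℝ] E :=
    { toFun := fun w => Complex.I • w
      map_add' := fun w w' => smul_add _ _ _
      map_smul' := fun r w => smul_comm _ _ _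
      cont := continuous_const_smul _ }
  have hJ : ∀ w, (T.comp J) w = T (Complex.I • w) := fun w => rfl
  have hfun : (fun x => T (f x • v x)) =
      fun x => (f x).re • T (v x) + (f x).im • (T.comp J) (v x) := by
    funext x
    rw [hJ]
    exact map_complex_smul_eq (T : E →ₗ[ℝ] V) (f x) (v x)
  rw [hfun]
  have hre : ContDiffAt ℝ n (fun x => (f x).re) x₀ := Complex.reCLM.contDiff.contDiffAt.comp x₀ hf
  have him : ContDiffAt ℝ n (fun x => (f x).im) x₀ := Complex.imCLM.contDiff.contDiffAt.comp x₀ hf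
  exact (hre.smul (hv T)).add (him.smul (hv (T.comp J)))

end Smul

end Literature.NumberTheory.Automorphic
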